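import Summits.Ventures.PercRepro.ProfileGapMonoThresholdNullityThreeTop

/-!
# PercRepro — THE TOP THRESHOLD AT NULLITY `4`, STEP 2: the fibre bound of the unit map on a simple matroid
(p5, gen 32; `proofs/P5-GM1.md` §44(b))

At nullity `#E = ρ(E) + 4` and co-rank `q = 4`, a unit `(S, p)` — a four-point boundary target `S` of the top
threshold with a non-loop `p ∈ S` in the closure of `E ∖ S` — is claimed by the INDEPENDENT deficient sets `B`
(three points, rank `3`, spanning complement, a `5`-point plane `cl B`) with `p ∈ cl B ∖ B` and `cl B ∩ S = {p}`.
With `W = E ∖ S` (`ρ(E)` points), `Y = S ∖ p` and `Λ = {w ∈ W : ρ(E ∖ (Y ∪ w)) + 2 ≤ ρ(E)}` (the points of `W` in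
the dual closure of `Y`): a point of `W` outside a claimant `B` and outside `cl B` lies in `Λ`
(`mem_dual_closure_of_claimant_nullity_four`), the second point `p'` of `cl B ∖ B` lies in `W ∖ Λ`, so
`𝒦 := W ∖ Λ` misses EXACTLY one point of every claimant; on a SIMPLE matroid `#𝒦 ≥ 3`
(`three_le_card_compl_dual_closure`: otherwise the rank formula gives `ρ(𝒦 ∪ p) + 1 = #𝒦 ≤ 2` on a set of at most
three distinct points).  Hence `B ↦ (𝒦 ∖ B, B ∩ Λ)` injects the claimants into `𝒦 × (Λ.powersetCard (4 − #𝒦))`,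
of size `#𝒦 · C(ρ(E) − #𝒦, 4 − #𝒦) ≤ 3 · (ρ(E) − 3)` (`mul_choose_le_three_mul`), and
**`card_claimants_le_nullity_four`**: at most `3 · (ρ(E) − 3)` claimants per unit.  Nothing open is asserted.
-/

open scoped Matroid

namespace PercRepro.Cogirth

open Finset ThmH Skew Shadow Profile

variable {α : Type} [DecidableEq α] {N : Matroid α} [N.Finite]

/-- `k · C(r − k, 4 − k) ≤ 3 · (r − 3)` for `3 ≤ k ≤ r` and `5 ≤ r`. -/
theorem mul_choose_le_three_mul (r k : ℕ) (hk3 : 3 ≤ k) (hkr : k ≤ r) (hr : 5 ≤ r) :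
    k * (r - k).choose (4 - k) ≤ 3 * (r - 3) := by
  rcases Nat.lt_or_ge k 5 with hk | hk
  · interval_cases k
    · rw [show 4 - 3 = 1 by norm_num, Nat.choose_one_right]
    · rw [show 4 - 4 = 0 by norm_num, Nat.choose_zero_right]
      omega
  · rw [show 4 - k = 0 by omega, Nat.choose_zero_right]
    omega

section Fibre

variable (hn : (gr N).card = rk N (gr N) + 4)
  (hpair : ∀ x ∈ gr N, ∀ y ∈ gr N, x ≠ y → rk N {x, y} = 2)

/-- The complement of `S ∖ p` is `W ∪ p` for `W = E ∖ S` and `p ∈ S ⊆ E`. -/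
theorem gr_sdiff_erase_eq_insert {S : Finset α} (hSg : S ⊆ gr N) {p : α} (hp : p ∈ S) :
    gr N \ S.erase p = insert p (gr N \ S) := by
  ext x
  simp only [mem_sdiff, mem_erase, mem_insert, not_and]
  constructor
  · rintro ⟨hx, hxe⟩
    by_cases hxp : x = p
    · exact Or.inl hxp
    · exact Or.inr ⟨hx, fun hxS => absurd hxS (hxe hxp)⟩
  · rintro (rfl | ⟨hx, hxS⟩)
    · exact ⟨hSg hp, fun h => absurd rfl h⟩
    · exact ⟨hx, fun _ => hxS⟩

/-- For a boundary target `S` with `p ∈ S` in the closure of `E ∖ S`, the set `(E ∖ S) ∪ p` has rank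
`ρ(E) − 1`. -/
theorem rk_insert_sdiff_of_boundary {S : Finset α} (hSg : S ⊆ gr N) (hSb : rk N (gr N \ S) + 1 = rk N (gr N))
    {p : α} (hp : p ∈ S) (hpcl : p ∈ clF N (gr N \ S)) :
    rk N (insert p (gr N \ S)) = rk N (gr N) - 1 := by
  rw [rk_insert_eq (hSg hp) (sdiff_subset : gr N \ S ⊆ gr N), if_pos hpcl]
  omega

include hn hpair in
/-- **`W ∖ Λ` has at least three points on a simple matroid** (nullity `4`): for a boundary target `S` of four
points with a non-loop `p ∈ S` in the closure of `E ∖ S`, at least three points `w ∈ W = E ∖ S` have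
`ρ(E ∖ ((S ∖ p) ∪ w)) + 2 > ρ(E)` — otherwise every point of `Λ` is a coloop of `W ∪ p` and the rank formula gives
`ρ(W ∪ p) = #Λ + ρ(𝒦 ∪ p)`, i.e. `ρ(𝒦 ∪ p) + 1 = #𝒦 ≤ 2` on a set of `#𝒦 + 1 ≤ 3` distinct points, against
simplicity. -/
theorem three_le_card_compl_dual_closure {S : Finset α} (hSg : S ⊆ gr N) (hS4 : S.card = 4)
    (hSb : rk N (gr N \ S) + 1 = rk N (gr N)) {p : α} (hp : p ∈ S) (hp1 : rk N {p} = 1)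
    (hpcl : p ∈ clF N (gr N \ S)) :
    3 ≤ ((gr N \ S) \ (gr N \ S).filter
      (fun w => rk N (gr N \ insert w (S.erase p)) + 2 ≤ rk N (gr N))).card := by
  set W := gr N \ S with hWdef
  set Λ := W.filter (fun w => rk N (gr N \ insert w (S.erase p)) + 2 ≤ rk N (gr N)) with hΛdef
  set 𝒦 := W \ Λ with h𝒦def
  have hpg : p ∈ gr N := hSg hp
  have hW : W ⊆ gr N := sdiff_subset
  have hpW : p ∉ W := fun h => (mem_sdiff.1 h).2 hp
  have hWcard : W.card = rk N (gr N) := by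
    have : W.card + S.card = (gr N).card := card_sdiff_add_card_eq_card hSg
    omega
  have hΛW : Λ ⊆ W := filter_subset _ _
  have h𝒦W : 𝒦 ⊆ W := sdiff_subset
  have hΛcard : 𝒦.card + Λ.card = W.card := card_sdiff_add_card_eq_card hΛW
  have hrkY : rk N (insert p W) = rk N (gr N) - 1 := rk_insert_sdiff_of_boundary hSg hSb hp hpcl
  have hD : 𝒦 ∪ {p} ⊆ gr N := union_subset (h𝒦W.trans hW) (singleton_subset_iff.2 hpg)
  -- the rank formula: every point of Λ is a coloop of W ∪ p
  have hform := rk_union_eq_card_add_of_forall (N := N) (𝒦 ∪ {p}) hD Λ (hΛW.trans hW) (fun w hw => ?_)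
  · have hunion : Λ ∪ (𝒦 ∪ {p}) = insert p W := by
      ext x
      simp only [mem_union, mem_singleton, mem_insert, h𝒦def, mem_sdiff]
      constructor
      · rintro (hx | ⟨hx, _⟩ | rfl)
        · exact Or.inr (hΛW hx)
        · exact Or.inr hx
        · exact Or.inl rfl
      · rintro (rfl | hx)
        · exact Or.inr (Or.inr rfl)
        · by_cases hxΛ : x ∈ Λ
          · exact Or.inl hxΛ
          · exact Or.inr (Or.inl ⟨hx, hxΛ⟩)
    rw [hunion, hrkY] at hform
    -- ρ(𝒦 ∪ p) + 1 = #𝒦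
    have hrk𝒦 : rk N (𝒦 ∪ {p}) + 1 = 𝒦.card := by omega
    by_contra hlt
    have hp1' : rk N {p} ≤ rk N (𝒦 ∪ {p}) := rk_mono' (M := N) subset_union_right
    -- #𝒦 = 2 and 𝒦 ∪ p has rank 1, but a pair has rank 2
    have h𝒦2 : 𝒦.card = 2 := by omega
    obtain ⟨w, hw⟩ : 𝒦.Nonempty := card_pos.1 (by omega)
    have hwp : w ≠ p := fun h => hpW (h ▸ h𝒦W hw)
    have hpair' : rk N {w, p} = 2 := hpair w (hW (h𝒦W hw)) p hpg hwp
    have hsub : ({w, p} : Finset α) ⊆ 𝒦 ∪ {p} := by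
      intro x hx
      rcases mem_insert.1 hx with rfl | hx
      · exact mem_union_left _ hw
      · exact mem_union_right _ hx
    have := rk_mono' (M := N) hsub
    omega
  · -- the witness for w ∈ Λ: W' = E ∖ ((S ∖ p) ∪ w)
    have hwW : w ∈ W := hΛW hw
    have hwΛ : rk N (gr N \ insert w (S.erase p)) + 2 ≤ rk N (gr N) := (mem_filter.1 hw).2
    have hwp : w ≠ p := fun h => hpW (h ▸ hwW)
    refine ⟨gr N \ insert w (S.erase p), sdiff_subset, ?_, ?_⟩
    · intro x hx
      rcases mem_union.1 hx with hx | hx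
      · obtain ⟨hxw, hxΛ⟩ := mem_erase.1 hx
        have hxW := hΛW hxΛ
        refine mem_sdiff.2 ⟨hW hxW, ?_⟩
        simp only [mem_insert, mem_erase, not_or, not_and]
        exact ⟨hxw, fun _ => (mem_sdiff.1 hxW).2⟩
      · rcases mem_union.1 hx with hx | hx
        · have hxW := h𝒦W hx
          refine mem_sdiff.2 ⟨hW hxW, ?_⟩
          simp only [mem_insert, mem_erase, not_or, not_and]
          exact ⟨fun h => (mem_sdiff.1 hx).2 (h ▸ hw), fun _ => (mem_sdiff.1 hxW).2⟩
        · rw [mem_singleton.1 hx]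
          refine mem_sdiff.2 ⟨hpg, ?_⟩
          simp only [mem_insert, mem_erase, ne_eq, not_true_eq_false, false_and, or_false]
          exact fun h => hwp h.symm
    · rw [mem_clF_iff_rk_insert (hW hwW) sdiff_subset]
      have h2 : insert w (gr N \ insert w (S.erase p)) = insert p W := by
        ext x
        simp only [mem_insert, mem_sdiff, mem_erase, not_or, not_and, hWdef]
        constructor
        · rintro (rfl | ⟨hx, hxw, hxe⟩)
          · exact Or.inr (mem_sdiff.1 hwW)
          · by_cases hxp : x = p
            · exact Or.inl hxp
            · exact Or.inr ⟨hx, fun hxS => hxe hxp hxS⟩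
        · rintro (rfl | ⟨hx, hxS⟩)
          · exact Or.inr ⟨hpg, fun h => hwp h.symm, fun h => absurd rfl h⟩
          · by_cases hxw : x = w
            · exact Or.inl hxw
            · exact Or.inr ⟨hx, hxw, fun _ => hxS⟩
      rw [h2, hrkY]
      omega

include hn in
/-- **A point of `W` outside a claimant and outside its plane lies in `Λ`**: for `B` of rank `3` with a
`5`-point plane and `cl B ∩ (S ∖ p) = ∅`, a point `w ∈ W = E ∖ S` with `w ∉ cl B` has
`ρ(E ∖ ((S ∖ p) ∪ w)) + 2 ≤ ρ(E)` (the dual-rank-`2` bound on the four points `(S ∖ p) ∪ w` of `E ∖ cl B`). -/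
theorem mem_dual_closure_of_claimant_nullity_four {S : Finset α} (hSg : S ⊆ gr N) (hS4 : S.card = 4) {p : α}
    (hp : p ∈ S) {B : Finset α} (hB : B ∈ Rq N 3) (hcl : (clF N B).card = 5)
    (hBS : clF N B ∩ S.erase p = ∅) {w : α} (hw : w ∈ gr N \ S) (hwcl : w ∉ clF N B) :
    rk N (gr N \ insert w (S.erase p)) + 2 ≤ rk N (gr N) := by
  have hF : (clF N B).card + rk N (gr N) = (gr N).card + (4 - 3) := by omega
  have hX : insert w (S.erase p) ⊆ gr N \ clF N B := by
    intro x hx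
    rcases mem_insert.1 hx with rfl | hx
    · exact mem_sdiff.2 ⟨(mem_sdiff.1 hw).1, hwcl⟩
    · refine mem_sdiff.2 ⟨hSg (mem_of_mem_erase hx), fun hxB => ?_⟩
      have : x ∈ clF N B ∩ S.erase p := mem_inter.2 ⟨hxB, hx⟩
      rw [hBS] at this
      exact notMem_empty x this
  have hwS : w ∉ S.erase p := fun h => (mem_sdiff.1 hw).2 (mem_of_mem_erase h)
  have hcard : (insert w (S.erase p)).card = 4 := by
    rw [card_insert_of_notMem hwS, card_erase_of_mem hp, hS4]
  have h := rk_sdiff_add_card_le_of_subset_compl (q := 4) hB hF (by norm_num) hX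
  omega

include hn hpair in
/-- **THE FIBRE BOUND AT NULLITY `4` ON A SIMPLE MATROID**: `ρ(E) ≥ 5`, a unit `(S, p)` — `S` a four-point
boundary target of the top threshold at co-rank `4`, `p ∈ S` a non-loop in the closure of `E ∖ S` — has at most
`3 · (ρ(E) − 3)` claimants: independent deficient sets `B ∈ Rq N 3` (three points, spanning complement,
`#cl B = 5`) with `p ∈ cl B ∖ B` and `cl B ∩ (S ∖ p) = ∅`. -/
theorem card_claimants_le_nullity_four (hR : 5 ≤ rk N (gr N)) {S : Finset α}
    (hSg : S ⊆ gr N) (hS4 : S.card = 4) (hSb : rk N (gr N \ S) + 1 = rk N (gr N)) {p : α} (hp : p ∈ S)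
    (hp1 : rk N {p} = 1) (hpcl : p ∈ clF N (gr N \ S)) :
    ((Rq N 3).filter (fun B => rk N (gr N \ B) = rk N (gr N) ∧ (clF N B).card = 5 ∧ B.card = 3 ∧
      p ∈ clF N B ∧ p ∉ B ∧ clF N B ∩ S.erase p = ∅)).card ≤ 3 * (rk N (gr N) - 3) := by
  set R := rk N (gr N) with hRdef
  set W := gr N \ S with hWdef
  set Λ := W.filter (fun w => rk N (gr N \ insert w (S.erase p)) + 2 ≤ R) with hΛdef
  set 𝒦 := W \ Λ with h𝒦def
  set 𝔅 := (Rq N 3).filter (fun B => rk N (gr N \ B) = R ∧ (clF N B).card = 5 ∧ B.card = 3 ∧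
    p ∈ clF N B ∧ p ∉ B ∧ clF N B ∩ S.erase p = ∅) with h𝔅def
  have hpg : p ∈ gr N := hSg hp
  have hW : W ⊆ gr N := sdiff_subset
  have hpW : p ∉ W := fun h => (mem_sdiff.1 h).2 hp
  have hWcard : W.card = R := by
    have : W.card + S.card = (gr N).card := card_sdiff_add_card_eq_card hSg
    omega
  have hΛW : Λ ⊆ W := filter_subset _ _
  have h𝒦W : 𝒦 ⊆ W := sdiff_subset
  have hΛcard : 𝒦.card + Λ.card = W.card := card_sdiff_add_card_eq_card hΛW
  have h𝒦3 : 3 ≤ 𝒦.card := three_le_card_compl_dual_closure hn hpair hSg hS4 hSb hp hp1 hpcl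
  have hrkY : rk N (insert p W) = R - 1 := rk_insert_sdiff_of_boundary hSg hSb hp hpcl
  -- every claimant lies in W
  have hBW : ∀ B ∈ 𝔅, B ⊆ W := by
    intro B hB x hx
    obtain ⟨hBq, _, _, _, _, hpB, hBS⟩ := mem_filter.1 hB
    have hBg : B ⊆ gr N := (mem_Rq.1 hBq).1
    refine mem_sdiff.2 ⟨hBg hx, fun hxS => ?_⟩
    have hxp : x ≠ p := fun h => hpB (h ▸ hx)
    have : x ∈ clF N B ∩ S.erase p := mem_inter.2 ⟨subset_clF hBg hx, mem_erase.2 ⟨hxp, hxS⟩⟩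
    rw [hBS] at this
    exact notMem_empty x this
  -- 𝒦 misses exactly one point of every claimant
  have hmiss : ∀ B ∈ 𝔅, (𝒦 \ B).card = 1 := by
    intro B hB
    obtain ⟨hBq, hBsp, hcl, hB3, hpcl', hpB, hBS⟩ := mem_filter.1 hB
    have hBg : B ⊆ gr N := (mem_Rq.1 hBq).1
    have hsub : 𝒦 \ B ⊆ (clF N B \ B).erase p := by
      intro w hw
      obtain ⟨hw𝒦, hwB⟩ := mem_sdiff.1 hw
      obtain ⟨hwW, hwΛ⟩ := mem_sdiff.1 hw𝒦
      have hwp : w ≠ p := fun h => hpW (h ▸ hwW)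
      refine mem_erase.2 ⟨hwp, mem_sdiff.2 ⟨?_, hwB⟩⟩
      by_contra hwcl
      exact hwΛ (mem_filter.2 ⟨hwW, mem_dual_closure_of_claimant_nullity_four hn hSg hS4 hp hBq hcl hBS hwW hwcl⟩)
    have hcard1 : ((clF N B \ B).erase p).card = 1 := by
      have h1 := card_sdiff_add_card_eq_card (subset_clF hBg)
      rw [card_erase_of_mem (mem_sdiff.2 ⟨hpcl', hpB⟩)]
      omega
    have hle : (𝒦 \ B).card ≤ 1 := hcard1 ▸ card_le_card hsub
    -- the second point p' of cl B ∖ B lies in 𝒦 ∖ B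
    obtain ⟨p', hp'⟩ : ((clF N B \ B).erase p).Nonempty := card_pos.1 (by omega)
    have hp'p : p' ≠ p := (mem_erase.1 hp').1
    have hp'cl : p' ∈ clF N B := (mem_sdiff.1 (mem_erase.1 hp').2).1
    have hp'B : p' ∉ B := (mem_sdiff.1 (mem_erase.1 hp').2).2
    have hp'g : p' ∈ gr N := clF_subset_gr B hp'cl
    have hp'S : p' ∉ S := fun h => by
      have : p' ∈ clF N B ∩ S.erase p := mem_inter.2 ⟨hp'cl, mem_erase.2 ⟨hp'p, h⟩⟩
      rw [hBS] at this
      exact notMem_empty p' this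
    have hp'W : p' ∈ W := mem_sdiff.2 ⟨hp'g, hp'S⟩
    have hp'Λ : p' ∉ Λ := by
      intro hΛ
      have hle2 := (mem_filter.1 hΛ).2
      -- B ⊆ E ∖ ((S ∖ p) ∪ p'), so p' ∈ cl of it and the rank is that of E ∖ (S ∖ p)
      have hBsub : B ⊆ gr N \ insert p' (S.erase p) := by
        intro x hx
        refine mem_sdiff.2 ⟨hBg hx, ?_⟩
        simp only [mem_insert, mem_erase, not_or, not_and]
        exact ⟨fun h => hp'B (h ▸ hx), fun _ hxS => (mem_sdiff.1 (hBW B hB hx)).2 hxS⟩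
      have hp'cl2 : p' ∈ clF N (gr N \ insert p' (S.erase p)) := clF_mono hBsub hp'cl
      have heq : insert p' (gr N \ insert p' (S.erase p)) = insert p W := by
        rw [← gr_sdiff_erase_eq_insert hSg hp]
        ext x
        simp only [mem_insert, mem_sdiff, mem_erase, not_or, not_and]
        constructor
        · rintro (rfl | ⟨hx, _, hxe⟩)
          · exact ⟨hp'g, fun hxp hxS => hp'S hxS⟩
          · exact ⟨hx, hxe⟩
        · rintro ⟨hx, hxe⟩
          by_cases hxp' : x = p'
          · exact Or.inl hxp'
          · exact Or.inr ⟨hx, hxp', hxe⟩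
      have h3 := rk_insert_eq hp'g (sdiff_subset : gr N \ insert p' (S.erase p) ⊆ gr N)
      rw [if_pos hp'cl2, heq, hrkY] at h3
      omega
    have hmem : p' ∈ 𝒦 \ B := mem_sdiff.2 ⟨mem_sdiff.2 ⟨hp'W, hp'Λ⟩, hp'B⟩
    have hge : 1 ≤ (𝒦 \ B).card := card_pos.2 ⟨p', hmem⟩
    omega
  -- the injection B ↦ (𝒦 ∖ B, B ∩ Λ)
  have hdecomp : ∀ B ∈ 𝔅, B = (𝒦 \ (𝒦 \ B)) ∪ (B ∩ Λ) := by
    intro B hB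
    ext x
    constructor
    · intro hx
      by_cases hxΛ : x ∈ Λ
      · exact mem_union_right _ (mem_inter.2 ⟨hx, hxΛ⟩)
      · refine mem_union_left _ (mem_sdiff.2 ⟨mem_sdiff.2 ⟨hBW B hB hx, hxΛ⟩, fun h => ?_⟩)
        exact (mem_sdiff.1 h).2 hx
    · intro hx
      rcases mem_union.1 hx with hx | hx
      · obtain ⟨hx𝒦, hx'⟩ := mem_sdiff.1 hx
        by_contra hxB
        exact hx' (mem_sdiff.2 ⟨hx𝒦, hxB⟩)
      · exact (mem_inter.1 hx).1
  have hcardΛ : ∀ B ∈ 𝔅, (B ∩ Λ).card = 4 - 𝒦.card := by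
    intro B hB
    obtain ⟨_, _, _, hB3, _, _, _⟩ := mem_filter.1 hB
    have h1 : (𝒦 \ B).card + (𝒦 ∩ B).card = 𝒦.card := card_sdiff_add_card_inter 𝒦 B
    have h2 : (B \ Λ).card + (B ∩ Λ).card = B.card := card_sdiff_add_card_inter B Λ
    have h3 : B \ Λ = 𝒦 ∩ B := by
      ext x
      simp only [mem_sdiff, mem_inter, h𝒦def]
      constructor
      · rintro ⟨hx, hxΛ⟩
        exact ⟨⟨hBW B hB hx, hxΛ⟩, hx⟩
      · rintro ⟨⟨_, hxΛ⟩, hx⟩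
        exact ⟨hx, hxΛ⟩
    have h4 := hmiss B hB
    rw [h3] at h2
    omega
  have himage : 𝔅.card ≤ ((𝒦.powersetCard 1) ×ˢ (Λ.powersetCard (4 - 𝒦.card))).card := by
    refine card_le_card_of_injOn (fun B => (𝒦 \ B, B ∩ Λ)) (fun B hB => ?_) (fun B₁ hB₁ B₂ hB₂ heq => ?_)
    · exact mem_product.2 ⟨mem_powersetCard.2 ⟨sdiff_subset, hmiss B hB⟩,
        mem_powersetCard.2 ⟨inter_subset_right, hcardΛ B hB⟩⟩
    · simp only [Prod.mk.injEq] at heq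
      obtain ⟨h1, h2⟩ := heq
      rw [hdecomp B₁ hB₁, hdecomp B₂ hB₂, h1, h2]
  rw [card_product, card_powersetCard, card_powersetCard, Nat.choose_one_right] at himage
  have hΛ : Λ.card = R - 𝒦.card := by omega
  rw [hΛ] at himage
  have h𝒦R : 𝒦.card ≤ R := by omega
  exact himage.trans (mul_choose_le_three_mul R 𝒦.card h𝒦3 h𝒦R hR)

end Fibre

end PercRepro.Cogirth
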